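import Literature.Computability.QuantumComplexity.LetterWord
import Literature.Computability.QuantumComplexity.JonesSamplerAnalysis
import HarnessLib

/-!
# The error budget of the AJL core family, and the indexing of its trials

Topic `Literature/Computability/QuantumComplexity`; a step in the discharge of
`ajl_jonesApproxProblem_mem_PromiseBQP`. Two self-contained pieces of arithmetic used by the core
family (`CoreFamily.lean`, size parameter `t`, `k = 2t + 60` averaging bits, `m = 384 t²` copies,
`r = t` slots, `2(2t-1)` letters):

* `letterErr_even`: with an even number `2j` of averaging bits the letter error is
  `(72 + 18√2)/2^j`, and `budget`: `384 t² · (t · (2(2t−1) · letterErr (2t+60))) ≤ 1/6`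
  (via `pow_four_le : t⁴ ≤ 21 · 2^t`);
* `toTrial`: the equivalence `Fin (2K) ≃ Bool × Fin K` sending the last `K` copies to the
  imaginary-part trials, used to identify the copies with the sampler's trials
  (`JonesSamplerAnalysis.lean`).

## References

* D. Aharonov, V. Jones, Z. Landau, Algorithmica 55 (2009), §3.3 and Thm. 4.3 (polynomially small
  gate errors suffice) [AharonovJonesLandau2009].
-/

noncomputable section

namespace Literature.Computability.QuantumComplexity

namespace AJLCore

/-! ### The error budget -/

/-- `t⁴ ≤ 21 · 2^t`. [folklore] -/
theorem pow_four_le (t : ℕ) : t ^ 4 ≤ 21 * 2 ^ t := by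
  -- small cases by evaluation, then induction from `16`
  suffices h : ∀ t, 16 ≤ t → t ^ 4 ≤ 2 ^ t by
    by_cases ht : t < 16
    · interval_cases t <;> norm_num
    · exact (h t (by omega)).trans (Nat.le_mul_of_pos_left _ (by norm_num))
  intro t ht
  induction t with
  | zero => omega
  | succ s ih =>
    rcases Nat.eq_or_lt_of_le ht with h16 | hlt
    · rw [← h16]; decide
    · have hs : 16 ≤ s := by omega
      have ih' := ih hs
      -- `(s+1)⁴ ≤ 2 s⁴` for `s ≥ 16`
      have key : (s + 1) ^ 4 ≤ 2 * s ^ 4 := by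
        have h1 : (s + 1) ^ 4 = s ^ 4 + 4 * s ^ 3 + 6 * s ^ 2 + 4 * s + 1 := by ring
        have h2 : 4 * s ^ 3 + 6 * s ^ 2 + 4 * s + 1 ≤ s ^ 4 := by
          have : 4 * s ^ 3 + 6 * s ^ 2 + 4 * s + 1 ≤ 15 * s ^ 3 := by nlinarith
          calc 4 * s ^ 3 + 6 * s ^ 2 + 4 * s + 1 ≤ 15 * s ^ 3 := this
            _ ≤ s * s ^ 3 := Nat.mul_le_mul_right _ (by omega)
            _ = s ^ 4 := by ring
        rw [h1]; omega
      calc (s + 1) ^ 4 ≤ 2 * s ^ 4 := key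
        _ ≤ 2 * 2 ^ s := Nat.mul_le_mul_left _ ih'
        _ = 2 ^ (s + 1) := by ring

/-- The letter error with an even number of averaging bits: `(72 + 18√2)/2^j`.
[cite: AharonovJonesLandau2009, Thm. 4.3] -/
theorem letterErr_even (j : ℕ) : GadgetKit.letterErr (2 * j) = (72 + 18 * Real.sqrt 2) / 2 ^ j := by
  unfold GadgetKit.letterErr GadgetKit.rotErr GadgetKit.phaseErr
  have h2j : (2 : ℝ) ^ (2 * j) = (2 ^ j) ^ 2 := by rw [pow_mul, pow_right_comm]
  have hpos : (0 : ℝ) < 2 ^ j := by positivity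
  have e1 : Real.sqrt (2 * (2 / 2 ^ (2 * j))) = 2 / 2 ^ j := by
    rw [h2j, show (2 : ℝ) * (2 / (2 ^ j) ^ 2) = (2 / 2 ^ j) ^ 2 by ring, Real.sqrt_sq (by positivity)]
  have e2 : Real.sqrt (2 * (4 / 2 ^ (2 * j))) = Real.sqrt 2 * (2 / 2 ^ j) := by
    rw [h2j, show (2 : ℝ) * (4 / (2 ^ j) ^ 2) = 2 * (2 / 2 ^ j) ^ 2 by ring, Real.sqrt_mul (by norm_num), Real.sqrt_sq (by positivity)]
  rw [e1, e2]
  field_simp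
  ring

/-- **The error budget**: `m · wordErr ≤ 1/6` for the family's parameters.
[cite: AharonovJonesLandau2009, Thm. 4.3] -/
theorem budget (t : ℕ) : (384 * t ^ 2 : ℝ) * (t * ((2 * (2 * t - 1) : ℕ) * GadgetKit.letterErr (2 * t + 60))) ≤ 1 / 6 := by
  rw [show 2 * t + 60 = 2 * (t + 30) by ring, letterErr_even]
  have hsqrt : Real.sqrt 2 ≤ 1.5 := by
    rw [show (1.5 : ℝ) = Real.sqrt (1.5 ^ 2) by rw [Real.sqrt_sq (by norm_num)]]
    exact Real.sqrt_le_sqrt (by norm_num)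
  have hle : (72 + 18 * Real.sqrt 2) ≤ 99 := by linarith
  have hA : ((2 * (2 * t - 1) : ℕ) : ℝ) ≤ 4 * t := by
    have : 2 * (2 * t - 1) ≤ 4 * t := by omega
    exact_mod_cast this
  have ht4 : (t : ℝ) ^ 4 ≤ 21 * 2 ^ t := by exact_mod_cast pow_four_le t
  have hpow : (2 : ℝ) ^ (t + 30) = 2 ^ t * 2 ^ 30 := by rw [pow_add]
  have h2t : (0 : ℝ) < 2 ^ t := by positivity
  -- assemble
  calc (384 * t ^ 2 : ℝ) * (t * ((2 * (2 * t - 1) : ℕ) * ((72 + 18 * Real.sqrt 2) / 2 ^ (t + 30))))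
      ≤ (384 * t ^ 2 : ℝ) * (t * ((4 * t) * (99 / 2 ^ (t + 30)))) := by
        gcongr
    _ = 384 * 4 * 99 * (t : ℝ) ^ 4 / (2 ^ t * 2 ^ 30) := by rw [hpow]; ring
    _ ≤ 384 * 4 * 99 * (21 * 2 ^ t) / (2 ^ t * 2 ^ 30) := by gcongr
    _ = 384 * 4 * 99 * 21 / 2 ^ 30 := by field_simp
    _ ≤ 1 / 6 := by norm_num

/-! ### The trials -/

variable (K : ℕ)

/-- Copy `j < 2K` is the trial `(j ≥ K, j mod K)`: the first `K` copies estimate the real part, the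
last `K` the imaginary part. [cite: AharonovJonesLandau2009, §3.3] -/
def toTrial : Fin (2 * K) ≃ Bool × Fin K where
  toFun j := (decide (K ≤ (j : ℕ)), ⟨(j : ℕ) % K, Nat.mod_lt _ (by have := j.2; omega)⟩)
  invFun p := ⟨(if p.1 then K else 0) + p.2, by have := p.2.2; split_ifs <;> omega⟩
  left_inv j := by
    have hj := j.2
    ext
    simp only
    by_cases h : K ≤ (j : ℕ)
    · have : (j : ℕ) % K = j - K := by
        rw [Nat.mod_eq_sub_mod h, Nat.mod_eq_of_lt (by omega)]
      simp only [h, decide_true, if_true, this]; omega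
    · simp only [h, decide_false, Bool.false_eq_true, if_false, zero_add]; exact Nat.mod_eq_of_lt (by omega)
  right_inv p := by
    obtain ⟨b, i⟩ := p
    have hi := i.2
    cases b
    · simp only [Bool.false_eq_true, if_false, zero_add, Prod.mk.injEq]
      exact ⟨decide_eq_false (by omega), Fin.ext (Nat.mod_eq_of_lt hi)⟩
    · simp only [if_true, Prod.mk.injEq]
      refine ⟨decide_eq_true (by omega), Fin.ext ?_⟩
      simp [Nat.add_mod_left, Nat.mod_eq_of_lt hi]

/-- The type of a copy is the first component of its trial. [folklore] -/
theorem toTrial_fst (j : Fin (2 * K)) : (toTrial K j).1 = decide (K ≤ (j : ℕ)) := rfl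

/-- **Reindexing products over copies as products over trials.** [folklore] -/
theorem prod_copies_eq_prod_trials (f : Bool × Fin K → ℝ) : ∏ j : Fin (2 * K), f (toTrial K j) = ∏ p : Bool × Fin K, f p :=
  Fintype.prod_equiv (toTrial K) _ _ fun _ => rfl

/-- **Reindexing sums over copy patterns as sums over trial patterns.** [folklore] -/
theorem sum_patterns_eq (F : (Bool × Fin K → Bool) → ℝ) :
    ∑ γ : Fin (2 * K) → Bool, F (γ ∘ (toTrial K).symm) = ∑ γ' : Bool × Fin K → Bool, F γ' :=
  Fintype.sum_equiv ((toTrial K).arrowCongr (Equiv.refl Bool)) _ _ fun γ => by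
    congr 1

end AJLCore

end Literature.Computability.QuantumComplexity

end
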